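import Literature.Geometry.Lorentzian.KerrRedShiftEstimate

/-!
# Route ClusterCompleteness — crux `AdiabaticMultiKerrILED`, line `Sketch`:
# removing the receding weight from a slab inequality (exhaustion `ε ↓ 0`)

Helper file for the crux `stmt-FinalStateConjecture-14310`
(`Summit.FinalStateConjecture.FinalStateConjecture.Theses.ClusterCompleteness.AdiabaticMultiKerrILED`),
line `Sketch`, stub `slab_lintegral_le_of_weighted_le` (lead c7, wave 7).

Setting (one zone, zero spin, rest frame of the static tails-cut Schwarzschild zone): the weighted
vector-field currents of the line produce real (Bochner) slab inequalities
`∫_{(0,s]} ∫_{ℝ³} W_{ε,R}(x) g(x) dy du ≤ A`, `x = (u + F(y), y)` the leaf parametrisation, with the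
weight `W_{ε,R} = χ(u₂/ε − 1) · χ(2 − ‖x⃗‖²/R²)` (`χ = Real.smoothTransition`,
`u₂ = Kerr.horizonFn M 0` the receding horizon function) and an `ε`-independent bound `A`.

* `slab_lintegral_le_of_weighted_le` — **the registered stub**: the unweighted Lebesgue bound
  `∫⁻_{(0,s]} ∫⁻_{2M < ‖y‖ ≤ R} g(u + F(y), y) ≤ A` in `[0, ∞]`. On the region the cone factor is
  `1` and the horizon factor is `1` as soon as `2ε ≤ u₂ = (‖y‖ − 2M) e^{−(u+F(y))/(2M)}`, so the
  weighted integrands (continuous on `ℝ × ℝ³`: near leaf points with `r ≤ 2M` the weight vanishes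
  identically; compactly supported in `y`; non-negative) increase to `g` on the region along
  `ε_n = ε₁/(n+1)`; the real inequality is rewritten with Lebesgue integrals
  (`MeasureTheory.ofReal_integral_eq_lintegral_ofReal` in `y` and in `u`) and monotone convergence
  (`MeasureTheory.lintegral_iSup` in `y` and in `u`) passes to the limit.

Dafermos–Rodnianski–Shlapentokh-Rothman arXiv:1402.7034, §13.2 (the limit `ε → 0` of the receding
cut-off). [folklore]
-/

noncomputable section

-- the doubled `FinalStateConjecture.FinalStateConjecture` path component trips dupNamespace
set_option linter.dupNamespace false

open Set Filter Metric MeasureTheory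
open scoped Topology ENNReal
open Literature.Geometry.Lorentzian

namespace Summit.FinalStateConjecture.FinalStateConjecture.Theorems

/-- **Removing the receding weight from a slab inequality** (crux `stmt-FinalStateConjecture-14310`,
line `Sketch`, stub `slab_lintegral_le_of_weighted_le`). Let `M, R > 0`, `F` continuous, `s ≥ 0`,
`g` continuous and non-negative at the points with `r > 2M`. If for every `ε > 0` with
`16 ε e^{(s+|F(0)|+2R)/(2M)} ≤ M` the weighted slab integral
`∫_{(0,s]} ∫ χ(u₂(x)/ε − 1) χ(2 − ‖x⃗‖²/R²) g(x) dy du`, `x = (u + F(y), y)`, is at most `A`, then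
`∫⁻_{(0,s]} ∫⁻_{2M < ‖y‖ ≤ R} g(u + F(y), y) ≤ A` in `[0, ∞]`: the weighted integrands are
continuous, non-negative, supported in `‖y‖ ≤ 2R`, and increase to `g` on the region along
`ε_n = ε₁/(n+1)`, `ε₁ = M e^{−(s+|F(0)|+2R)/(2M)}/16` (Bochner = Lebesgue for them, then monotone
convergence in `y` and in `u`). DRSR arXiv:1402.7034, §13.2. [folklore] -/
theorem slab_lintegral_le_of_weighted_le : ∀ (M R : ℝ) (F : E3 → ℝ) (g : E4 → ℝ) (s A : ℝ), 0 < M → 0 < R → Continuous F → 0 ≤ s → (∀ x : E4, 2 * M < Kerr.radius 0 x → ContinuousAt g x ∧ 0 ≤ g x) → (∀ ε : ℝ, 0 < ε → 16 * ε * Real.exp ((s + |F 0| + 2 * R) / (2 * M)) ≤ M → ∫ u in Set.Ioc 0 s, ∫ y : E3, (Real.smoothTransition (Kerr.horizonFn M 0 (E4.ofTimeSpace (u + F y) y) / ε - 1) * Real.smoothTransition (2 - E4.spatialNorm (E4.ofTimeSpace (u + F y) y) ^ 2 / R ^ 2)) * g (E4.ofTimeSpace (u + F y) y) ≤ A) →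 ∫⁻ u in Set.Ioc 0 s, ∫⁻ y in {y : E3 | 2 * M < ‖y‖ ∧ ‖y‖ ≤ R}, ENNReal.ofReal (g (E4.ofTimeSpace (u + F y) y)) ≤ ENNReal.ofReal A := by
  intro M R F g s A hM hR hF _hs hg hA
  -- ### notation
  set w : ℝ → E4 → ℝ := fun ε x ↦ Real.smoothTransition (Kerr.horizonFn M 0 x / ε - 1) *
    Real.smoothTransition (2 - E4.spatialNorm x ^ 2 / R ^ 2) with hw
  set p : ℝ → E4 → ℝ := fun ε x ↦ w ε x * g x with hp
  set L : ℝ → E3 → E4 := fun u y ↦ E4.ofTimeSpace (u + F y) y with hL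
  set S : Set E3 := {y : E3 | 2 * M < ‖y‖ ∧ ‖y‖ ≤ R} with hS
  set f : ℝ → E3 → ℝ≥0∞ := fun u y ↦ ENNReal.ofReal (g (L u y)) with hf
  set q : ℝ → ℝ → E3 → ℝ≥0∞ := fun ε u y ↦ ENNReal.ofReal (p ε (L u y)) with hq
  show ∫⁻ u in Ioc 0 s, ∫⁻ y in S, f u y ≤ ENNReal.ofReal A
  -- ### the leaf parametrisation
  have hLc : Continuous fun z : ℝ × E3 ↦ L z.1 z.2 :=
    E4.continuous_ofTimeSpace' (continuous_fst.add (hF.comp continuous_snd)) continuous_snd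
  have hLu : ∀ u, Continuous (L u) := fun u ↦
    E4.continuous_ofTimeSpace' (continuous_const.add hF) continuous_id
  have hLnorm : ∀ u y, E4.spatialNorm (L u y) = ‖y‖ := fun u y ↦ E4.spatialNorm_ofTimeSpace _ _
  have hLrad : ∀ u y, Kerr.radius 0 (L u y) = ‖y‖ := fun u y ↦ by
    rw [Kerr.radius_zero_left, hLnorm]
  have hSm : MeasurableSet S :=
    (isOpen_lt continuous_const continuous_norm).measurableSet.inter
      (isClosed_le continuous_norm continuous_const).measurableSet
  have hpos : ∀ u y, 2 * M < ‖y‖ → 0 < Kerr.horizonFn M 0 (L u y) := fun u y hy ↦ by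
    unfold Kerr.horizonFn
    rw [Kerr.rPlus_zero_right hM.le, hLrad]
    exact mul_pos (sub_pos.mpr hy) (Real.exp_pos _)
  -- ### the weight: `0 ≤ w ≤ 1`, `w ≠ 0 ⇒ r > 2M ∧ ‖x⃗‖ ≤ 2R`, `w = 1` on the core, monotone in `ε`
  have hw0 : ∀ ε x, 0 ≤ w ε x := fun ε x ↦
    mul_nonneg (Real.smoothTransition.nonneg _) (Real.smoothTransition.nonneg _)
  have hw1 : ∀ ε x, w ε x ≤ 1 := fun ε x ↦
    mul_le_one₀ (Real.smoothTransition.le_one _) (Real.smoothTransition.nonneg _)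
      (Real.smoothTransition.le_one _)
  have hwr : ∀ ε, 0 < ε → ∀ x, w ε x ≠ 0 → 2 * M < Kerr.radius 0 x := fun ε hε x hx ↦ by
    rw [← Kerr.rPlus_zero_right hM.le]
    exact Kerr.rPlus_lt_radius_of_horizonFn_pos
      (hε.trans (Kerr.lt_horizonFn_of_weight_ne_zero hε (left_ne_zero_of_mul hx)))
  have hwn : ∀ ε x, w ε x ≠ 0 → E4.spatialNorm x ≤ 2 * R := fun ε x hx ↦ by
    have h2 := right_ne_zero_of_mul hx
    have hlt : 0 < 2 - E4.spatialNorm x ^ 2 / R ^ 2 := by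
      by_contra hle
      exact h2 (Real.smoothTransition.zero_of_nonpos (not_lt.mp hle))
    have hR2 : 0 < R ^ 2 := by positivity
    have h3 : E4.spatialNorm x ^ 2 / R ^ 2 < 2 := by linarith
    rw [div_lt_iff₀ hR2] at h3
    have hn0 := E4.spatialNorm_nonneg x
    nlinarith [h3, hn0, hR, sq_nonneg (E4.spatialNorm x - 2 * R)]
  have hwone : ∀ ε, 0 < ε → ∀ u y, ‖y‖ ≤ R → 2 * ε ≤ Kerr.horizonFn M 0 (L u y) →
      w ε (L u y) = 1 := by
    intro ε hε u y hyR hh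
    show Real.smoothTransition _ * Real.smoothTransition _ = 1
    rw [Kerr.weight_eq_one_of_le_horizonFn hε hh, one_mul]
    refine Real.smoothTransition.one_of_one_le ?_
    rw [hLnorm]
    have : ‖y‖ ^ 2 / R ^ 2 ≤ 1 := by
      rw [div_le_one (by positivity)]
      exact pow_le_pow_left₀ (norm_nonneg _) hyR 2
    linarith
  have hwc : ∀ ε, Continuous (w ε) := fun ε ↦
    (Real.smoothTransition.continuous.comp
      (((Kerr.continuous_horizonFn M 0).div_const ε).sub continuous_const)).mul
      (Real.smoothTransition.continuous.comp
        (continuous_const.sub ((E4.continuous_spatialNorm.pow 2).div_const _)))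
  -- ### the weighted density `p = w g`: non-negative and continuous on `ℝ⁴`
  have hp0 : ∀ ε, 0 < ε → ∀ x, 0 ≤ p ε x := fun ε hε x ↦ by
    by_cases hx : w ε x = 0
    · show 0 ≤ w ε x * g x
      rw [hx, zero_mul]
    · exact mul_nonneg (hw0 ε x) (hg x (hwr ε hε x hx)).2
  have hpc : ∀ ε, 0 < ε → Continuous (p ε) := fun ε hε ↦ by
    have hK : IsClosed {x : E4 | ε ≤ Kerr.horizonFn M 0 x} :=
      isClosed_le continuous_const (Kerr.continuous_horizonFn M 0)
    have hKU : {x : E4 | ε ≤ Kerr.horizonFn M 0 x} ⊆ {x : E4 | 2 * M < Kerr.radius 0 x} := by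
      intro x hx
      have h := Kerr.rPlus_lt_radius_of_horizonFn_pos (hε.trans_le hx)
      rwa [Kerr.rPlus_zero_right hM.le] at h
    have hwK : ∀ x, x ∉ {x : E4 | ε ≤ Kerr.horizonFn M 0 x} → w ε x = 0 := fun x hx ↦ by
      have hlt : Kerr.horizonFn M 0 x < ε := not_le.mp hx
      have h1 : Real.smoothTransition (Kerr.horizonFn M 0 x / ε - 1) = 0 :=
        Real.smoothTransition.zero_of_nonpos (by rw [sub_nonpos, div_le_one hε]; exact hlt.le)
      show Real.smoothTransition (Kerr.horizonFn M 0 x / ε - 1) * _ = 0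
      rw [h1, zero_mul]
    exact continuous_iff_continuousAt.mpr fun x ↦
      continuousAt_weight_mul hK hKU (hwc ε) hwK (fun x hx ↦ (hg x hx).1) x
  -- ### Step 1: the weighted Lebesgue bound for admissible `ε`
  have hstep : ∀ ε, 0 < ε → 16 * ε * Real.exp ((s + |F 0| + 2 * R) / (2 * M)) ≤ M →
      ∫⁻ u in Ioc 0 s, ∫⁻ y, q ε u y ≤ ENNReal.ofReal A := by
    intro ε hε hεM
    have hkey : ∫ u in Ioc 0 s, ∫ y, p ε (L u y) ≤ A := hA ε hε hεM
    have hpLc : Continuous fun z : ℝ × E3 ↦ p ε (L z.1 z.2) := (hpc ε hε).comp hLc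
    have hpLu : ∀ u, Continuous fun y ↦ p ε (L u y) := fun u ↦ (hpc ε hε).comp (hLu u)
    -- support in the ball of radius `2R`
    have hzero : ∀ u y, y ∉ closedBall (0 : E3) (2 * R) → p ε (L u y) = 0 := by
      intro u y hy
      by_contra hne
      have h := hwn ε _ (left_ne_zero_of_mul hne)
      rw [hLnorm] at h
      exact hy (mem_closedBall_zero_iff.mpr h)
    have hint : ∀ u, Integrable fun y ↦ p ε (L u y) := fun u ↦
      (hpLu u).integrable_of_hasCompactSupport
        (HasCompactSupport.intro (isCompact_closedBall _ _) (hzero u))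
    have hball : ∀ u, ∫ y in closedBall (0 : E3) (2 * R), p ε (L u y) = ∫ y, p ε (L u y) :=
      fun u ↦ setIntegral_eq_integral_of_forall_compl_eq_zero fun y hy ↦ hzero u y hy
    have hPc : Continuous fun u ↦ ∫ y, p ε (L u y) :=
      (continuous_parametric_integral_of_continuous (f := fun (u : ℝ) (y : E3) ↦ p ε (L u y))
        hpLc (isCompact_closedBall (0 : E3) (2 * R))).congr hball
    have hPnn : ∀ u, 0 ≤ ∫ y, p ε (L u y) := fun u ↦ integral_nonneg fun y ↦ hp0 ε hε _
    have hPi : IntegrableOn (fun u ↦ ∫ y, p ε (L u y)) (Ioc 0 s) :=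
      hPc.integrableOn_Icc.mono_set Ioc_subset_Icc_self
    calc ∫⁻ u in Ioc 0 s, ∫⁻ y, q ε u y
        = ∫⁻ u in Ioc 0 s, ENNReal.ofReal (∫ y, p ε (L u y)) :=
          lintegral_congr fun u ↦
            (ofReal_integral_eq_lintegral_ofReal (hint u) (ae_of_all _ fun y ↦ hp0 ε hε _)).symm
      _ = ENNReal.ofReal (∫ u in Ioc 0 s, ∫ y, p ε (L u y)) :=
          (ofReal_integral_eq_lintegral_ofReal hPi (ae_of_all _ fun u ↦ hPnn u)).symm
      _ ≤ ENNReal.ofReal A := ENNReal.ofReal_le_ofReal hkey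
  -- ### Step 2: the receding parameters `ε_n = ε₁/(n+1)`
  set E : ℝ := Real.exp ((s + |F 0| + 2 * R) / (2 * M)) with hE
  have hEpos : 0 < E := Real.exp_pos _
  set ε₁ : ℝ := M / (16 * E) with hε₁def
  have hε₁ : 0 < ε₁ := by positivity
  have hε₁M : 16 * ε₁ * E = M := by
    rw [hε₁def]
    field_simp
  set εn : ℕ → ℝ := fun n ↦ ε₁ / ((n : ℝ) + 1) with hεn
  have hεnpos : ∀ n, 0 < εn n := fun n ↦ by positivity
  have hεnM : ∀ n, 16 * εn n * E ≤ M := fun n ↦ by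
    have hn1 : (1 : ℝ) ≤ (n : ℝ) + 1 := by linarith only [n.cast_nonneg (α := ℝ)]
    calc 16 * εn n * E = 16 * ε₁ * E / ((n : ℝ) + 1) := by simp only [hεn]; ring
      _ ≤ 16 * ε₁ * E := div_le_self (by positivity) hn1
      _ = M := hε₁M
  have hεnanti : ∀ n m : ℕ, n ≤ m → εn m ≤ εn n := fun n m hnm ↦ by
    have hcast : (n : ℝ) + 1 ≤ (m : ℝ) + 1 := by
      have h := (Nat.cast_le (α := ℝ)).mpr hnm
      linarith
    have hn1 : (0 : ℝ) < (n : ℝ) + 1 := by positivity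
    exact div_le_div_of_nonneg_left hε₁.le hn1 hcast
  have hwmono : ∀ x, 0 ≤ Kerr.horizonFn M 0 x → Monotone fun n ↦ w (εn n) x := by
    intro x hx n m hnm
    refine mul_le_mul_of_nonneg_right (Real.smoothTransition.monotone ?_)
      (Real.smoothTransition.nonneg _)
    have h1 : Kerr.horizonFn M 0 x / εn n ≤ Kerr.horizonFn M 0 x / εn m :=
      div_le_div_of_nonneg_left hx (hεnpos m) (hεnanti n m hnm)
    linarith
  -- ### Step 3: on the region the weighted densities increase to `g`
  have hmonoG : ∀ u, Monotone fun n ↦ S.indicator (q (εn n) u) := by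
    intro u n m hnm y
    by_cases hy : y ∈ S
    · simp only [Set.indicator_of_mem hy]
      refine ENNReal.ofReal_le_ofReal ?_
      show w (εn n) (L u y) * g (L u y) ≤ w (εn m) (L u y) * g (L u y)
      exact mul_le_mul_of_nonneg_right (hwmono _ (hpos u y hy.1).le hnm)
        (hg _ (by rw [hLrad]; exact hy.1)).2
    · simp only [Set.indicator_of_notMem hy, le_refl]
  have hsup : ∀ u y, S.indicator (f u) y = ⨆ n, S.indicator (q (εn n) u) y := by
    intro u y
    by_cases hy : y ∈ S
    · simp only [Set.indicator_of_mem hy]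
      have hh := hpos u y hy.1
      have hg0 : 0 ≤ g (L u y) := (hg _ (by rw [hLrad]; exact hy.1)).2
      refine le_antisymm ?_ (iSup_le fun n ↦ ?_)
      · obtain ⟨n, hn⟩ := exists_nat_ge (2 * ε₁ / Kerr.horizonFn M 0 (L u y))
        refine le_iSup_of_le n (le_of_eq ?_)
        have hn1 : (0 : ℝ) < (n : ℝ) + 1 := by positivity
        have h2 : 2 * εn n ≤ Kerr.horizonFn M 0 (L u y) := by
          rw [div_le_iff₀ hh] at hn
          show 2 * (ε₁ / ((n : ℝ) + 1)) ≤ Kerr.horizonFn M 0 (L u y)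
          rw [mul_div_assoc', div_le_iff₀ hn1]
          nlinarith
        show ENNReal.ofReal (g (L u y)) = ENNReal.ofReal (w (εn n) (L u y) * g (L u y))
        rw [hwone (εn n) (hεnpos n) u y hy.2 h2, one_mul]
      · exact ENNReal.ofReal_le_ofReal (mul_le_of_le_one_left hg0 (hw1 _ _))
    · simp only [Set.indicator_of_notMem hy, iSup_const]
  -- ### measurability
  have hqm : ∀ n u, Measurable (S.indicator (q (εn n) u)) := fun n u ↦
    (ENNReal.measurable_ofReal.comp ((hpc _ (hεnpos n)).comp (hLu u)).measurable).indicator hSm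
  have hGm : ∀ n, Measurable fun u ↦ ∫⁻ y, S.indicator (q (εn n) u) y := by
    intro n
    have h2 : Measurable fun z : ℝ × E3 ↦
        (Prod.snd ⁻¹' S).indicator (fun z ↦ q (εn n) z.1 z.2) z :=
      (ENNReal.measurable_ofReal.comp ((hpc _ (hεnpos n)).comp hLc).measurable).indicator
        (measurable_snd hSm)
    have heq : (fun u ↦ ∫⁻ y, S.indicator (q (εn n) u) y) = fun u : ℝ ↦ ∫⁻ y : E3,
        (Prod.snd ⁻¹' S).indicator (fun z : ℝ × E3 ↦ q (εn n) z.1 z.2) (u, y) := by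
      funext u
      refine lintegral_congr fun y ↦ ?_
      by_cases hy : y ∈ S
      · have hy' : (u, y) ∈ Prod.snd ⁻¹' S := hy
        rw [Set.indicator_of_mem hy, Set.indicator_of_mem hy']
      · have hy' : (u, y) ∉ Prod.snd ⁻¹' S := hy
        rw [Set.indicator_of_notMem hy, Set.indicator_of_notMem hy']
    rw [heq]
    exact h2.lintegral_prod_right'
  -- ### assembly: monotone convergence in `y` and in `u`
  calc ∫⁻ u in Ioc 0 s, ∫⁻ y in S, f u y
      = ∫⁻ u in Ioc 0 s, ∫⁻ y, S.indicator (f u) y :=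
        lintegral_congr fun u ↦ (lintegral_indicator hSm _).symm
    _ = ∫⁻ u in Ioc 0 s, ∫⁻ y, ⨆ n, S.indicator (q (εn n) u) y :=
        lintegral_congr fun u ↦ lintegral_congr fun y ↦ hsup u y
    _ = ∫⁻ u in Ioc 0 s, ⨆ n, ∫⁻ y, S.indicator (q (εn n) u) y :=
        lintegral_congr fun u ↦ lintegral_iSup (fun n ↦ hqm n u) (hmonoG u)
    _ = ⨆ n, ∫⁻ u in Ioc 0 s, ∫⁻ y, S.indicator (q (εn n) u) y :=
        lintegral_iSup hGm (fun n m hnm u ↦ lintegral_mono fun y ↦ hmonoG u hnm y)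
    _ ≤ ENNReal.ofReal A := iSup_le fun n ↦
        (lintegral_mono fun u ↦ lintegral_mono fun y ↦ Set.indicator_le_self _ _ _).trans
          (hstep _ (hεnpos n) (hεnM n))

end Summit.FinalStateConjecture.FinalStateConjecture.Theorems
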